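import Summits.Ventures.AbcSig.Rows.Bridge
import Summits.Ventures.AbcSig.Rows.C2aL311A3X
import Summits.Ventures.AbcSig.Rows.C2aL311A3XAB

/-!
# Venture AbcSig — CELL `C2aL311A3`: the census statement `Rows.C2aCellRed 311 (fun a => a = 3) {11}` from the two row theorems

HONEST FRAMING. COMPUTATION cell `pub-abcsig`; CONDITIONAL theorem; no claim on ABC or any summit. Hypotheses exactly as
in `Rows/C2aL311A3X.lean` and `Rows/C2aL311A3XAB.lean`: `BS04Package` (CITED), `DataComplete …` (COMPUTED level files), `EisPackage` (CITED) and `Refines` (COMPUTED) for the M6 orbits discharged in the kernel, and the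
rows' per-orbit exclusions for BOTH family predicates (`famB`, `famAB`) as universally quantified hypotheses (CITED: the census
row's certificates). Conclusion = p1's census predicate (`Rows/Statements.lean`), all four coprime coefficient
distributions `A·B = 2^a·311^m`, reduced exponents `a < n`, `m < n` (RULING H1). GENERATED by p-lean gen/make_rows.py
(after plean/make_cell_bridges.py).
-/

namespace Summit.Ventures.AbcSig

/-- Cell `C2aL311A3` (M6 orbits discharged in the kernel): `Rows.C2aCellRed 311 (fun a => a = 3) {11}` under the rows' hypotheses. -/
theorem xcell_C2aL311A3 (M : NewformModel) (hP : M.BS04Package)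
    (hE : M.EisPackage)
    (hD622 : M.DataComplete 622 level622Orbits)
    (hD9952 : M.DataComplete 9952 level9952Orbits)
    (hR_orbit_622_4 : M.Refines 622 orbit_622_4 m6X_622_4)
    (hX_orbit_9952_9 : ∀ n m : ℕ, n ∈ ([13] : List ℕ) → M.Excludes 9952 orbit_9952_9 (famB (2 ^ 3 * 311 ^ m) n (fun _ _ => True)))
    (hX_orbit_9952_9' : ∀ n m : ℕ, n ∈ ([13] : List ℕ) → M.Excludes 9952 orbit_9952_9 (famAB (311 ^ m) (2 ^ 3) n (fun _ _ => True)))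
    (hX_orbit_9952_10 : ∀ n m : ℕ, n ∈ ([13] : List ℕ) → M.Excludes 9952 orbit_9952_10 (famB (2 ^ 3 * 311 ^ m) n (fun _ _ => True)))
    (hX_orbit_9952_10' : ∀ n m : ℕ, n ∈ ([13] : List ℕ) → M.Excludes 9952 orbit_9952_10 (famAB (311 ^ m) (2 ^ 3) n (fun _ _ => True))) :
    Rows.C2aCellRed 311 (fun a => a = 3) {11} :=
  C2aCellRed_of_rows 311 (by norm_num) (by norm_num) _ _
    (fun n hn h11 hnℓ hR a m (ha : a = 3) han hm hmn x y z h1 h2 => by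
      subst ha
      exact
 xrow_C2aL311A3 M hP hE hD622 hD9952 hR_orbit_622_4 n hn h11 hnℓ (by simpa using hR) m hm hmn (hX_orbit_9952_9 n m) (hX_orbit_9952_10 n m) x y z h1 h2)
    (fun n hn h11 hnℓ hR a m (ha : a = 3) han hm hmn x y z h1 h2 => by
      subst ha
      exact
 xrow_C2aL311A3AB M hP hE hD622 hD9952 hR_orbit_622_4 n hn h11 hnℓ (by simpa using hR) m hm hmn (hX_orbit_9952_9' n m) (hX_orbit_9952_10' n m) x y z h1 h2)

end Summit.Ventures.AbcSig
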